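import Mathlib.Data.Matrix.Block
import Mathlib.LinearAlgebra.Matrix.Trace
import Mathlib.Algebra.Polynomial.AlgebraMap
import HarnessLib

/-!
# Route `PhantomRMYoshida`, crux `ResiduallyYoshidaLifting` (stmt-Langlands-13639): census F1
# "trace orthogonality" — a polynomial in a block-diagonal matrix is block diagonal, and is
# trace-orthogonal to every block off-diagonal matrix

Lead prover-line-stmt-Langlands-13639-c2-0 (2026-08-17), line `sector-klingen-split`, registered stub
`stub_traceOrthogonality` (`--supports stmt-Langlands-13639`).

Role.  Strategist finding F1 (`Cruxes/ResiduallyYoshidaLifting/STRATEGY-CENSUS.md` §3) is a BARRIER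
certificate for Taylor–Wiles patching at a residually SPLIT maximal ideal.  If the residual representation
is `ρ̄ = σ̄ ⊕ σ̄'` in an adapted basis, every `h = ρ̄(g)` is block diagonal, `h = fromBlocks A 0 0 D`.
A Thorne-type Taylor–Wiles datum at an auxiliary prime (Thorne 2012, Def. 4.1: the local deformation
problem attached to a generalised eigenspace of `h = ρ̄(Frob_v)`; Prop. 4.4: its tangent space and the
resulting bound on the dual Selmer group) sees `ρ̄(Frob_v)` only through the generalised-eigenspace
projector `e_{h,α}`, which is a POLYNOMIAL in `h`, `e = q(h) ∈ k[h]`, and it constrains a cocycle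
direction `w ∈ ad ρ̄` only through the trace pairing `tr(e · w)`.  The two identities recorded here,

* `aeval (fromBlocks A 0 0 D) q = fromBlocks (aeval A q) 0 0 (aeval D q)` — the algebra `R[h]`
  generated by a block-diagonal `h` consists of block-diagonal matrices, and
* `tr (q(h) * fromBlocks 0 w w' 0) = 0` — a block-diagonal matrix is trace-orthogonal to every block
  OFF-diagonal one,

say that such a datum is blind to the cross blocks `Hom(σ̄', σ̄) ⊕ Hom(σ̄, σ̄')` of `ad ρ̄`: the linear
conditions it imposes factor through the diagonal blocks, so no choice of Thorne-type Taylor–Wiles primes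
cuts down the cross part of the dual Selmer group.  This file is the two-line linear-algebra kernel of
F1, valid over any commutative ring `R` and any finite index types; the deformation-theoretic wrapping
(which Selmer group, which local condition, which `q`) lives in the census and is deliberately NOT here.

Contents (sorry-free, Mathlib only):

* `trace_fromBlocks_eq` — `tr (fromBlocks A B C D) = tr A + tr D` (Mathlib has no `trace_fromBlocks`;
  one line over `Fintype.sum_sum_type`);
* `aeval_fromBlocks_diagonal` — the first display, by `Polynomial.induction_on'` over Mathlib's
  `Matrix.fromBlocks_diagonal_pow`, `Matrix.fromBlocks_smul`, `Matrix.fromBlocks_add`;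
* `trace_aeval_fromBlocks_diagonal_mul_offDiagonal` — the second display;
* **`stub_traceOrthogonality`** (registered signature, verbatim) — the conjunction of the two.
-/

-- `Summit.Langlands.Langlands.…` (summit = sub-problem name, D-0017 layout) trips `dupNamespace` on every decl.
set_option linter.dupNamespace false
set_option autoImplicit false

namespace Summit.Langlands.Langlands.Cruxes.ResiduallyYoshidaLifting.SectorKlingenSplit

open Polynomial

/-- The trace of a `2 × 2` block matrix is the sum of the traces of its two diagonal blocks:
`tr (fromBlocks A B C D) = tr A + tr D` (any additive commutative monoid of coefficients, any finite
index types). [folklore] -/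
theorem trace_fromBlocks_eq {R : Type*} [AddCommMonoid R] {m n : Type*} [Fintype m] [Fintype n]
    (A : Matrix m m R) (B : Matrix m n R) (C : Matrix n m R) (D : Matrix n n R) :
    (Matrix.fromBlocks A B C D).trace = A.trace + D.trace := by
  simp [Matrix.trace, Fintype.sum_sum_type]

/-- A polynomial in a block-diagonal matrix is block diagonal, with diagonal blocks the same polynomial
in the blocks: `q(fromBlocks A 0 0 D) = fromBlocks q(A) 0 0 q(D)` for every `q ∈ R[X]`, `R` a
commutative ring.  Equivalently: the `R`-algebra generated by a block-diagonal matrix consists of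
block-diagonal matrices.  Proof: additivity plus the monomial case, which is Mathlib's
`Matrix.fromBlocks_diagonal_pow`. [folklore] -/
theorem aeval_fromBlocks_diagonal {R : Type*} [CommRing R] {m n : Type*} [Fintype m] [Fintype n]
    [DecidableEq m] [DecidableEq n] (A : Matrix m m R) (D : Matrix n n R) (q : R[X]) :
    aeval (Matrix.fromBlocks A 0 0 D) q = Matrix.fromBlocks (aeval A q) 0 0 (aeval D q) := by
  induction q using Polynomial.induction_on' with
  | add p q hp hq =>
    rw [aeval_add, aeval_add, aeval_add, hp, hq, Matrix.fromBlocks_add, add_zero, add_zero]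
  | monomial k a =>
    simp only [aeval_monomial, Algebra.algebraMap_eq_smul_one, smul_mul_assoc, one_mul,
      Matrix.fromBlocks_diagonal_pow, Matrix.fromBlocks_smul, smul_zero]

/-- Trace orthogonality of block-diagonal against block off-diagonal matrices, in the form census F1
uses it: for every polynomial `q` and every block OFF-diagonal `W = fromBlocks 0 w w' 0`,
`tr (q(fromBlocks A 0 0 D) * W) = 0`.  Indeed `q(fromBlocks A 0 0 D) = fromBlocks q(A) 0 0 q(D)`
(`aeval_fromBlocks_diagonal`), the product is `fromBlocks 0 (q(A) w) (q(D) w') 0`, and its diagonal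
blocks — hence its trace — vanish. [folklore] -/
theorem trace_aeval_fromBlocks_diagonal_mul_offDiagonal {R : Type*} [CommRing R] {m n : Type*}
    [Fintype m] [Fintype n] [DecidableEq m] [DecidableEq n] (A : Matrix m m R) (D : Matrix n n R)
    (q : R[X]) (w : Matrix m n R) (w' : Matrix n m R) :
    Matrix.trace (aeval (Matrix.fromBlocks A 0 0 D) q * Matrix.fromBlocks 0 w w' 0) = 0 := by
  rw [aeval_fromBlocks_diagonal, Matrix.fromBlocks_multiply, trace_fromBlocks_eq]
  simp

/-- **Registered stub `stub_traceOrthogonality`** (census §3 F1, kernel form).  For a commutative ring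
`R`, finite index types `m`, `n`, square blocks `A : Matrix m m R`, `D : Matrix n n R`, a polynomial
`q ∈ R[X]` and off-diagonal blocks `w : Matrix m n R`, `w' : Matrix n m R`:
(i) `q(fromBlocks A 0 0 D) = fromBlocks q(A) 0 0 q(D)` — an element of the algebra generated by a
block-diagonal matrix is block diagonal; and
(ii) `tr (q(fromBlocks A 0 0 D) * fromBlocks 0 w w' 0) = 0` — the trace of (block diagonal) × (block
off-diagonal) vanishes.  Consequence recorded in the census: a Thorne-type Taylor–Wiles condition, which
pairs cocycles against projectors `e_{h,α} ∈ k[h]`, `h = ρ̄(Frob_v)` block diagonal at a residually split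
`ρ̄ = σ̄ ⊕ σ̄'`, never sees the cross block `Hom(σ̄', σ̄)`. [folklore] -/
theorem stub_traceOrthogonality :
    ∀ (R : Type) [CommRing R] (m n : Type) [Fintype m] [Fintype n] [DecidableEq m] [DecidableEq n]
      (A : Matrix m m R) (D : Matrix n n R) (q : Polynomial R) (w : Matrix m n R) (w' : Matrix n m R),
      Polynomial.aeval (Matrix.fromBlocks A 0 0 D) q =
          Matrix.fromBlocks (Polynomial.aeval A q) 0 0 (Polynomial.aeval D q) ∧
        Matrix.trace (Polynomial.aeval (Matrix.fromBlocks A 0 0 D) q * Matrix.fromBlocks 0 w w' 0) = 0 := by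
  intro R _ m n _ _ _ _ A D q w w'
  exact ⟨aeval_fromBlocks_diagonal A D q, trace_aeval_fromBlocks_diagonal_mul_offDiagonal A D q w w'⟩

end Summit.Langlands.Langlands.Cruxes.ResiduallyYoshidaLifting.SectorKlingenSplit
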